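import Mathlib
import Summits.ValiantsHypothesis.ValiantsHypothesis.Theorems.MonotoneRestorationOrbitRestorationQPLevelMatch
import HarnessLib

/-!
# The matching data of a clean representation under a degree-preserving symmetry, EXPOSED (ORBIT currency)

Route MonotoneRestoration, crux `OrbitRestorationQP` (stmt-ValiantsHypothesis-18293), line `mixing-scale` (val-idea-12; registered
stubs M2 `stub_almostInvariantTerms`, M3 `stub_orbitClassSums`).  Namespaces `Summit.ValiantsHypothesis.ValiantsHypothesis.Theorems.
{ClusterMatching, LevelRep}`.  Route-independent (no `Theses` import).

The landed matching lemma `LevelRep.match_of_fix` (`…LevelMatch.lean`) builds, INSIDE its proof, the `ClusterMatching.MatchingData` of a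
clean minimal representation `R` of `f` and an algebra automorphism `φ` with `φ f = f` preserving total degrees: the signed family
`T_i` (left) / `−φ T_j` (right) summing to zero, every minimal vanishing sub-family MIXED (minimality of `R`) and `Rb`-CLOSE in rank
distance (the Saxena–Seshadhri rank bound through `RankBoundBridge.rdist_lt_of_minVanishing` for `≥ 3` terms, unique factorisation for
`2` terms), and then consumes it with a SEPARATED labelling.  The line `mixing-scale` needs the same data WITHOUT any labelling:

* `LevelRep.exists_matchingData_of_fix` — the matching data as an existential with its dictionary (`val (inl i) = T i`,
  `val (inr j) = −φ (T j)`, `Δ (inl i) (inr j) = rdist (L i) (act φ (L j))`, `δ = rdist`, `R = Rb m D`);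
* `LevelRep.exists_rdist_act_le` / `exists_rdist_act_le'` — **FACT A** of the line card: every term is within rank distance `Rb` of
  SOME `φ`-renamed term, and every `φ`-renamed term is within `Rb` of some term (the block of the decomposition into minimal vanishing
  sub-families containing it is mixed and close);
* `ClusterMatching.sum_add_sum_eq_zero_of_closed` — the abstract two-sided cancellation: for a signed family on `ι ⊕ ι` summing to
  zero with mixed vanishing sub-families, an index set `S` CLOSED under the left–right links of minimal vanishing sub-families has
  `Σ_{i ∈ S} val (inl i) + Σ_{j ∈ S} val (inr j) = 0` (decompose the whole family; a block meeting `S ⊕ S` lies inside it).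

Everything is proved modulo the named fact `depthThree_rankBound`, taken BY NAME as a hypothesis exactly as in `…LevelMatch.lean`.
Honest framing: inputs to one sub-rung of the first rung of the product-depth ladder under a tier-B crux; nothing here bears on
VP ≠ VNP. [cite: KarninShpilka2009, §3; SaxenaSeshadhri2013, Theorem 5]
-/

noncomputable section

open MvPolynomial Literature.Computability.AlgebraicComplexity

-- `Summit.ValiantsHypothesis.ValiantsHypothesis.…` is the tree's single-conjunct layout (Sub = Summit).
set_option linter.dupNamespace false

namespace Summit.ValiantsHypothesis.ValiantsHypothesis.Theorems

/-! ### The abstract two-sided cancellation over a closed index set -/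

namespace ClusterMatching

open Finset

universe u v

variable {ι : Type u} [Fintype ι] {M : Type v} [AddCommGroup M]

/-- **Closed index sets cancel.**  Let `val : ι ⊕ ι → M` sum to zero, with every nonempty vanishing sub-family meeting both copies of
`ι`.  If `S ⊆ ι` is CLOSED under the links of minimal vanishing sub-families (whenever one contains `inl i` and `inr j`, `i ∈ S ↔ j ∈ S`),
then `Σ_{i ∈ S} val (inl i) + Σ_{j ∈ S} val (inr j) = 0`. [folklore; cite: KarninShpilka2009, §3] -/
theorem sum_add_sum_eq_zero_of_closed (val : ι ⊕ ι → M) (total : ∑ x, val x = 0)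
    (mixed : ∀ s : Finset (ι ⊕ ι), s.Nonempty → Vanishing val s → (∃ i, Sum.inl i ∈ s) ∧ ∃ j, Sum.inr j ∈ s)
    (S : Finset ι)
    (hS : ∀ s : Finset (ι ⊕ ι), MinVanishing val s → ∀ i j : ι, Sum.inl i ∈ s → Sum.inr j ∈ s → (i ∈ S ↔ j ∈ S)) :
    ∑ i ∈ S, val (Sum.inl i) + ∑ j ∈ S, val (Sum.inr j) = 0 := by
  classical
  obtain ⟨𝒮, hmin, -, hdisj, huniv⟩ := exists_decomposition val univ total
  have hcover : ∀ x : ι ⊕ ι, ∃ t ∈ 𝒮, x ∈ t := by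
    intro x
    have hx := (Finset.ext_iff.1 huniv x).1 (mem_univ x)
    rw [mem_biUnion] at hx
    simpa using hx
  set U : Finset (ι ⊕ ι) := S.disjSum S with hU
  -- every block meeting `U` lies inside it
  have hblock : ∀ t ∈ 𝒮, ∀ x ∈ t, x ∈ U → t ⊆ U := by
    intro t ht x hx hxU y hy
    have hmt := hmin t ht
    obtain ⟨⟨i₁, hi₁⟩, ⟨j₁, hj₁⟩⟩ := mixed t hmt.1 hmt.2.1
    have hj₁S : j₁ ∈ S := by
      rcases x with i | j
      · exact (hS t hmt i j₁ hx hj₁).1 (Finset.inl_mem_disjSum.1 hxU)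
      · exact (hS t hmt i₁ j₁ hi₁ hj₁).1 ((hS t hmt i₁ j hi₁ hx).2 (Finset.inr_mem_disjSum.1 hxU))
    have hi₁S : i₁ ∈ S := (hS t hmt i₁ j₁ hi₁ hj₁).2 hj₁S
    rcases y with i' | j'
    · exact Finset.inl_mem_disjSum.2 ((hS t hmt i' j₁ hy hj₁).2 hj₁S)
    · exact Finset.inr_mem_disjSum.2 ((hS t hmt i₁ j' hi₁ hy).1 hi₁S)
  -- `U` is the disjoint union of the blocks it contains
  have hUeq : U = (𝒮.filter fun t => t ⊆ U).biUnion id := by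
    ext x
    simp only [mem_biUnion, mem_filter, id]
    constructor
    · intro hx
      obtain ⟨t, ht, hxt⟩ := hcover x
      exact ⟨t, ⟨ht, hblock t ht x hxt hx⟩, hxt⟩
    · rintro ⟨t, ⟨-, htU⟩, hxt⟩
      exact htU hxt
  have hsumU : ∑ x ∈ U, val x = 0 := by
    rw [hUeq, sum_biUnion]
    · exact sum_eq_zero fun t ht => (hmin t (mem_filter.1 ht).1).2.1
    · intro t ht t' ht' hne
      exact hdisj (mem_filter.1 ht).1 (mem_filter.1 ht').1 hne
  rw [hU, Finset.sum_disjSum] at hsumU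
  exact hsumU

end ClusterMatching

/-! ### The matching data at a level, exposed -/

namespace LevelRep

open RankDistance ClusterMatching RankBoundBridge LinNL

variable {K : Type} [Field K] {V : Type} [Fintype V] [DecidableEq V] [DecidableEq (MvPolynomial V K)]

/-- **THE MATCHING DATA AT A LEVEL.**  For a clean minimal representation `R` of `f` and an algebra automorphism `φ` preserving total
degrees with `φ f = f`, the signed family `T_i` (left) / `−φ T_j` (right) is a `ClusterMatching.MatchingData` with rank distance
`Δ (inl i) (inr j) = rdist (L i) (act φ (L j))`, `δ = rdist` and constant `Rb R.m D`: it sums to zero, every nonempty vanishing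
sub-family is mixed (minimality of `R` and of `φ R`), and every minimal vanishing sub-family is `Rb`-close (two terms: equal factors by
unique factorisation; at least three: the rank bound).  Granting the Saxena–Seshadhri rank bound.  (This is the construction inside
`match_of_fix`, exposed.) [cite: KarninShpilka2009, §3; SaxenaSeshadhri2013, Theorem 5] -/
theorem exists_matchingData_of_fix (hRB : depthThree_rankBound) {f : MvPolynomial V K} {D : ℕ} (R : CleanRep f D)
    (φ : MvPolynomial V K ≃ₐ[K] MvPolynomial V K) (hφdeg : ∀ q, (φ q).totalDegree = q.totalDegree) (hφf : φ f = f) :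
    ∃ Dm : MatchingData (Fin R.m) (MvPolynomial V K),
      (∀ i, Dm.val (Sum.inl i) = R.T i) ∧ (∀ j, Dm.val (Sum.inr j) = -φ (R.T j)) ∧
      (∀ i j, Dm.Δ (Sum.inl i) (Sum.inr j) = rdist (R.L i) (act φ (R.L j))) ∧
      (∀ i j, Dm.δ i j = rdist (R.L i) (R.L j)) ∧ Dm.R = Rb R.m D := by
  classical
  -- the images of the factor multisets and their scalars
  have hv : ∀ j, ∃ v : K, v ≠ 0 ∧ ((R.L j).map φ).prod = C v * (act φ (R.L j)).prod := by
    intro j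
    have hrel : Multiset.Rel Associated (act φ (R.L j)) ((R.L j).map φ) := by
      rw [act, Multiset.rel_map]
      exact Multiset.rel_refl_of_refl_on fun q _ => nrm_associated (φ q)
    obtain ⟨w, hw⟩ := prod_associated_of_rel hrel
    obtain ⟨v, hv, hwv⟩ := MvPolynomial.isUnit_iff_eq_C_of_isReduced.1 w.isUnit
    exact ⟨v, hv.ne_zero, by rw [← hw, hwv, mul_comm]⟩
  choose v hv0 hv using hv
  -- the matching data
  let Λt : Fin R.m ⊕ Fin R.m → Multiset (MvPolynomial V K) := Sum.elim R.L fun j => act φ (R.L j)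
  let at' : Fin R.m ⊕ Fin R.m → K := Sum.elim R.a fun j => -(R.a j * v j)
  let val : Fin R.m ⊕ Fin R.m → MvPolynomial V K := fun x => C (at' x) * (Λt x).prod
  have hval_inl : ∀ i, val (Sum.inl i) = R.T i := fun i => rfl
  have hφC : ∀ c : K, φ (C c) = C c := fun c => by
    rw [← MvPolynomial.algebraMap_eq]; exact φ.commutes c
  have hval_inr : ∀ j, val (Sum.inr j) = -φ (R.T j) := fun j => by
    show C (-(R.a j * v j)) * (act φ (R.L j)).prod = -φ (C (R.a j) * (R.L j).prod)
    rw [map_mul, hφC, map_multiset_prod, hv j, map_neg, map_mul]; ring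
  have hΛdeg : ∀ x, ∀ q ∈ Λt x, q.totalDegree = 1 := by
    rintro (i | j) q hq
    · exact R.hdeg i q hq
    · obtain ⟨q', hq', rfl⟩ := Multiset.mem_map.1 hq
      rw [totalDegree_nrm, hφdeg]; exact R.hdeg j q' hq'
  have hΛnrm : ∀ x, IsNormalised (Λt x) := by
    rintro (i | j)
    · exact R.hnrm i
    · exact isNormalised_act φ (R.L j)
  have hΛcard : ∀ x, Multiset.card (Λt x) ≤ D := by
    rintro (i | j)
    · exact R.hcard i
    · simp only [Λt, Sum.elim_inr, act, Multiset.card_map]; exact R.hcard j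
  have hat0 : ∀ x, at' x ≠ 0 := by
    rintro (i | j)
    · exact R.ha i
    · exact neg_ne_zero.2 (mul_ne_zero (R.ha j) (hv0 j))
  have htotal : ∑ x, val x = 0 := by
    rw [Fintype.sum_sum_type]
    simp only [hval_inl, hval_inr, Finset.sum_neg_distrib, ← map_sum]
    have : ∑ i, R.T i = f := R.hsum
    rw [this, hφf, add_neg_cancel]
  -- mixedness from minimality
  have hmixed : ∀ s : Finset (Fin R.m ⊕ Fin R.m), s.Nonempty → Vanishing val s →
      (∃ i, Sum.inl i ∈ s) ∧ ∃ j, Sum.inr j ∈ s := by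
    intro s hs hvs
    have hsplit : ∑ x ∈ s, val x = ∑ i ∈ s.toLeft, R.T i - φ (∑ j ∈ s.toRight, R.T j) := by
      rw [← Finset.toLeft_disjSum_toRight (u := s), Finset.sum_disjSum, Finset.toLeft_disjSum_toRight]
      simp only [hval_inl, hval_inr, Finset.sum_neg_distrib, map_sum]
      ring
    unfold Vanishing at hvs
    rw [hsplit] at hvs
    constructor
    · by_contra h
      have hl : s.toLeft = ∅ := Finset.eq_empty_of_forall_notMem fun i hi => h ⟨i, Finset.mem_toLeft.1 hi⟩
      rw [hl, Finset.sum_empty, zero_sub, neg_eq_zero, map_eq_zero_iff φ φ.injective] at hvs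
      refine R.hmin s.toRight ?_ hvs
      obtain ⟨x, hx⟩ := hs
      rcases x with i | j
      · exact absurd ⟨i, hx⟩ h
      · exact ⟨j, Finset.mem_toRight.2 hx⟩
    · by_contra h
      have hr : s.toRight = ∅ := Finset.eq_empty_of_forall_notMem fun j hj => h ⟨j, Finset.mem_toRight.1 hj⟩
      rw [hr, Finset.sum_empty, map_zero, sub_zero] at hvs
      refine R.hmin s.toLeft ?_ hvs
      obtain ⟨x, hx⟩ := hs
      rcases x with i | j
      · exact ⟨i, Finset.mem_toLeft.2 hx⟩
      · exact absurd ⟨j, hx⟩ h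
  -- closeness from the rank bound
  have hclose : ∀ s : Finset (Fin R.m ⊕ Fin R.m), MinVanishing val s →
      ∀ x ∈ s, ∀ y ∈ s, rdist (Λt x) (Λt y) ≤ Rb R.m D := by
    intro s hs x hx y hy
    by_cases hxy : x = y
    · subst hxy; rw [rdist_self]; exact Nat.zero_le _
    have h2 : 2 ≤ s.card := Finset.one_lt_card.2 ⟨x, hx, y, hy, hxy⟩
    rcases Nat.lt_or_ge s.card 3 with h3 | h3
    · -- two terms: equal factor multisets
      have hs2 : s = {x, y} := by
        refine (Finset.eq_of_subset_of_card_le (fun z hz => ?_) ?_).symm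
        · simp only [Finset.mem_insert, Finset.mem_singleton] at hz
          rcases hz with rfl | rfl <;> assumption
        · rw [Finset.card_pair hxy]; omega
      have hsum2 : val x + val y = 0 := by
        have := hs.2.1
        unfold Vanishing at this
        rwa [hs2, Finset.sum_pair hxy] at this
      have := eq_of_add_eq_zero (hat0 x) (hΛdeg x) (hΛdeg y) (hΛnrm x) (hΛnrm y) hsum2
      rw [this, rdist_self]; exact Nat.zero_le _
    · -- at least three terms: the rank bound
      let ι := ↥s
      have hcardι : Fintype.card ι = s.card := Fintype.card_coe s
      have hvan' : ∑ z : ι, C (at' z) * (Λt z).prod = 0 := by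
        have := hs.2.1
        unfold Vanishing at this
        rw [← this, ← Finset.sum_coe_sort s]
      have hmin' : ∀ I : Finset ι, I.Nonempty → I ≠ Finset.univ → ∑ z ∈ I, C (at' z) * (Λt z).prod ≠ 0 := by
        intro I hI hIu h0
        set t : Finset (Fin R.m ⊕ Fin R.m) := I.map (Function.Embedding.subtype _) with ht
        have hts : t ⊆ s := fun z hz => by
          obtain ⟨w, -, rfl⟩ := Finset.mem_map.1 hz
          exact w.2
        have htne : t ≠ s := by
          intro hts'
          apply hIu
          apply Finset.eq_univ_of_card
          rw [Fintype.card_coe, ← hts', ht, Finset.card_map]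
        have htss : t ⊂ s := lt_of_le_of_ne hts htne
        refine hs.2.2 t htss (by simpa [ht] using hI) ?_
        unfold Vanishing
        rw [ht, Finset.sum_map]
        exact h0
      have hlt := rdist_lt_of_minVanishing hRB (fun z : ι => at' z) (fun z : ι => Λt z) D (fun z => hat0 z)
        (fun z => hΛdeg z) (fun z => hΛcard z)
        (fun z w q hq q' hq' hqq' => by rw [← hΛnrm z q hq, ← hΛnrm w q' hq', nrm_eq_of_associated hqq'])
        hvan' hmin' (by rw [hcardι]; exact h3) ⟨x, hx⟩ ⟨y, hy⟩
      refine (Nat.le_of_lt_succ (Nat.lt_succ_of_lt hlt)).trans ?_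
      unfold Rb
      rw [hcardι]
      have hsc : s.card ≤ 2 * R.m := by
        have := Finset.card_le_univ s
        rwa [Fintype.card_sum, Fintype.card_fin, ← two_mul] at this
      exact Nat.mul_le_mul_right _ (Nat.mul_le_mul_left _ (Nat.pow_le_pow_left hsc 2))
  let Dm : MatchingData (Fin R.m) (MvPolynomial V K) :=
    { val := val
      Δ := fun x y => rdist (Λt x) (Λt y)
      δ := fun i j => rdist (R.L i) (R.L j)
      R := Rb R.m D
      total := htotal
      symm := fun x y => rdist_comm _ _
      triangle := fun x y z => rdist_triangle _ _ _
      inl_inl := fun i j => rfl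
      inr_inr := fun i j => rdist_act φ (R.hnrm i) (R.hnrm j)
      close := hclose
      mixed := hmixed }
  exact ⟨Dm, hval_inl, hval_inr, fun _ _ => rfl, fun _ _ => rfl, rfl⟩

/-- **FACT A (left to right): every term is within rank distance `Rb` of SOME renamed term.**  For a clean minimal representation `R`
of `f` and a degree-preserving algebra automorphism `φ` with `φ f = f`, every `i` has a `j` with `rdist (L i) (act φ (L j)) ≤ Rb R.m D`
(the block of `inl i` in a decomposition of the matching data into minimal vanishing sub-families is mixed and close).  Granting the
Saxena–Seshadhri rank bound. [cite: KarninShpilka2009, §3; SaxenaSeshadhri2013, Theorem 5] -/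
theorem exists_rdist_act_le (hRB : depthThree_rankBound) {f : MvPolynomial V K} {D : ℕ} (R : CleanRep f D)
    (φ : MvPolynomial V K ≃ₐ[K] MvPolynomial V K) (hφdeg : ∀ q, (φ q).totalDegree = q.totalDegree) (hφf : φ f = f)
    (i : Fin R.m) : ∃ j : Fin R.m, rdist (R.L i) (act φ (R.L j)) ≤ Rb R.m D := by
  classical
  obtain ⟨Dm, -, -, hΔ, -, hR⟩ := exists_matchingData_of_fix hRB R φ hφdeg hφf
  obtain ⟨𝒮, hmin, -, -, huniv⟩ := exists_decomposition Dm.val Finset.univ Dm.total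
  have hx := (Finset.ext_iff.1 huniv (Sum.inl i)).1 (Finset.mem_univ _)
  obtain ⟨t, ht, hit⟩ := Finset.mem_biUnion.1 hx
  obtain ⟨-, ⟨j, hj⟩⟩ := Dm.mixed t (hmin t ht).1 (hmin t ht).2.1
  refine ⟨j, ?_⟩
  rw [← hΔ, ← hR]
  exact Dm.close t (hmin t ht) _ hit _ hj

/-- **FACT A (right to left): every renamed term is within rank distance `Rb` of some term.**  Same hypotheses; every `j` has an `i`
with `rdist (L i) (act φ (L j)) ≤ Rb R.m D`. [cite: KarninShpilka2009, §3; SaxenaSeshadhri2013, Theorem 5] -/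
theorem exists_rdist_act_le' (hRB : depthThree_rankBound) {f : MvPolynomial V K} {D : ℕ} (R : CleanRep f D)
    (φ : MvPolynomial V K ≃ₐ[K] MvPolynomial V K) (hφdeg : ∀ q, (φ q).totalDegree = q.totalDegree) (hφf : φ f = f)
    (j : Fin R.m) : ∃ i : Fin R.m, rdist (R.L i) (act φ (R.L j)) ≤ Rb R.m D := by
  classical
  obtain ⟨Dm, -, -, hΔ, -, hR⟩ := exists_matchingData_of_fix hRB R φ hφdeg hφf
  obtain ⟨𝒮, hmin, -, -, huniv⟩ := exists_decomposition Dm.val Finset.univ Dm.total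
  have hx := (Finset.ext_iff.1 huniv (Sum.inr j)).1 (Finset.mem_univ _)
  obtain ⟨t, ht, hjt⟩ := Finset.mem_biUnion.1 hx
  obtain ⟨⟨i, hi⟩, -⟩ := Dm.mixed t (hmin t ht).1 (hmin t ht).2.1
  refine ⟨i, ?_⟩
  rw [← hΔ, ← hR]
  exact Dm.close t (hmin t ht) _ hi _ hjt

end LevelRep

end Summit.ValiantsHypothesis.ValiantsHypothesis.Theorems

end
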